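import Mathlib
import HarnessLib
import Summits.Ventures.LatticeQCDFlow.Scoring.SplitChain
import Summits.Ventures.LatticeQCDFlow.Exactness.ApproxTrivializingSampler

/-!
# THE REGENERATION COINS OF AN INDEPENDENCE METROPOLIS SAMPLER ARE OBSERVABLE: Mykland–Tierney–Yu's
# retrospective coin ("after an accepted move `x → y`, heads with probability
# `e^{−M} max(w x, w y)`") realises the split kernel of `(K, π, e^{−M})` EXACTLY

HONEST FRAMING: exact (Metropolis-corrected) sampling algorithms for lattice gauge theory;
figures of merit are autocorrelation/cost numbers at stated couplings and volumes; no
continuum-physics claim.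

Venture `LatticeQCDFlow` (cell pub-lqcd), topic `Scoring`; FANOUT row 8 (`s0-cpn-nemc`, GEN-17).
NEW WORK of the cell, not a published result; no definition is introduced.  Every regenerative
certificate of the row (`Scoring/Regenerative*.lean`, `Scoring/IndepMHRegenerative*.lean`) is a
statement about the SPLIT CHAIN `κ̂` of a minorised kernel, whose coin coordinate is, a priori, part
of the law and not of the simulation; the files record "observability of the coins" as NOT CLAIMED.
For the independence Metropolis kernel `K = indepMH q w` (`q = ρ·π`, `w = 1/ρ`, `ρ x ≤ e^{M} ρ y`, so
`K(x, ·) ≥ e^{−M} π`, the tree's `Exactness.indepMH_exact_doeblin_of_density_ratio`) this file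
discharges it: augment one Metropolis step from `x` by the RETROSPECTIVE COIN — propose `y ∼ q`,
accept with probability `a(x, y) = min(1, w y / w x)`; if accepted flip heads with probability
`r(x, y) = e^{−M} max(w x, w y) ∈ [0, 1]`, if rejected record tails — and the resulting law on
`Ω × Bool` IS `e^{−M} π ⊗ δ_heads + (1 − e^{−M}) R(x, ·) ⊗ δ_tails`, the split kernel of
`Scoring/SplitChain.lean` with `R` the tree's residual kernel.  Hence (existence statement) there is a
Markov kernel on `Ω × Bool` which is SIMULTANEOUSLY the implementable coin-augmented sampler and a
split kernel, so all the regenerative error bars are statements about an implementable procedure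
that needs `w` only up to the constant `e^{−M}` (no normalising constant of `π`).  The two
identities: `∫_B a r dq = e^{−M} π(B)` (pointwise `ρ(y) · min(1, ρ x/ρ y) · max(1/ρ x, 1/ρ y) = 1`) and
`∫_B a (1 − r) dq + (1 − A(x)) 1_B(x) = K(x, B) − e^{−M} π(B) = (1 − e^{−M}) R(x, B)`.  Printed
counterpart NAMED ONLY: Mykland–Tierney–Yu 1995 (JASA 90) §4.1, eq. (11) (regeneration for
independence chains); Hobert–Jones–Presnell–Rosenthal 2002 §4 — nothing is cited as a fact.

## Content (`π`, `q = ρ·π` probability laws, `ρ > 0` measurable, `ρ x ≤ e^{M} ρ y`; `w = 1/ρ`;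
## `a = imhAcceptE w`, `A = imhAcceptMass q w`, `r(x,y) = e^{−M} max(w x, w y)`, `ε = e^{−M}`)

* `retroCoin_mem` — `0 ≤ r(x, y) ≤ 1`;
* **`indepMH_retro_heads`** — `∫⁻_{B} a(x,y) r(x,y) dq = ε π(B)`;
* **`indepMH_retro_tails`** — `∫⁻_{B} a(x,y) (1 − r(x,y)) dq + (1 − A x) 1_B(x) = (1 − ε) R(x, B)`;
* **`indepMH_retro_eq_split`** — the coin-augmented one-step law from `x` equals
  `(ε π).map (·, heads) + ((1 − ε) R x).map (·, tails)`;
* **`exists_indepMH_retroKernel`** — a Markov kernel on `Ω × Bool` equal to the coin-augmented law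
  at every `(x, b)` exists, and it satisfies the split-kernel equation of `Scoring/SplitChain.lean`.

NOT CLAIMED: any `M` for a concrete proposal; a sampling algorithm for `q` itself.
-/

noncomputable section

namespace Summit.Ventures.LatticeQCDFlow.Scoring

open MeasureTheory ProbabilityTheory Filter Summit.Ventures.LatticeQCDFlow.Exactness
open Literature.Probability.MarkovChains
open scoped ENNReal

variable {Ω : Type*} [MeasurableSpace Ω]

section Retro

variable {π q : Measure Ω} [IsProbabilityMeasure π] [IsProbabilityMeasure q] {ρ : Ω → ℝ} {M : ℝ}

/-- The retrospective coin probability `r(x, y) = e^{−M} max(1/ρ x, 1/ρ y)` lies in `[0, 1]`. -/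
theorem retroCoin_mem (hq : q = π.withDensity fun x => ENNReal.ofReal (ρ x))
    (hM : ∀ x y, ρ x ≤ Real.exp M * ρ y) (hρ0 : ∀ x, 0 < ρ x) (x y : Ω) :
    0 ≤ Real.exp (-M) * max (ρ x)⁻¹ (ρ y)⁻¹ ∧ Real.exp (-M) * max (ρ x)⁻¹ (ρ y)⁻¹ ≤ 1 := by
  have hb := fun z => (density_bounds_of_ratio_le hq hM z).1
  have hinv : ∀ z, (ρ z)⁻¹ ≤ Real.exp M := fun z => by
    calc (ρ z)⁻¹ ≤ (Real.exp (-M))⁻¹ := inv_anti₀ (Real.exp_pos _) (hb z)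
      _ = Real.exp M := by rw [Real.exp_neg, inv_inv]
  refine ⟨mul_nonneg (Real.exp_pos _).le ((inv_pos.2 (hρ0 x)).le.trans (le_max_left _ _)), ?_⟩
  calc Real.exp (-M) * max (ρ x)⁻¹ (ρ y)⁻¹ ≤ Real.exp (-M) * Real.exp M :=
        mul_le_mul_of_nonneg_left (max_le (hinv x) (hinv y)) (Real.exp_pos _).le
    _ = 1 := by rw [← Real.exp_add, neg_add_cancel, Real.exp_zero]

omit [IsProbabilityMeasure π] [IsProbabilityMeasure q] in
/-- The coin density is measurable in `y`. -/
theorem measurable_retroCoin (hρm : Measurable ρ) (x : Ω) :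
    Measurable fun y => ENNReal.ofReal (Real.exp (-M) * max (ρ x)⁻¹ (ρ y)⁻¹) :=
  (measurable_const.mul (measurable_const.max hρm.inv)).ennreal_ofReal

omit [IsProbabilityMeasure π] [IsProbabilityMeasure q] in
/-- **Heads part**: `∫⁻_{B} a(x,y) · r(x,y) q(dy) = e^{−M} · π(B)` — pointwise
`ρ(y) · min(1, ρ x / ρ y) · e^{−M} max(1/ρ x, 1/ρ y) = e^{−M}`. -/
theorem indepMH_retro_heads (hρm : Measurable ρ) (hρ0 : ∀ x, 0 < ρ x)
    (hq : q = π.withDensity fun x => ENNReal.ofReal (ρ x)) (x : Ω) {B : Set Ω}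
    (hB : MeasurableSet B) :
    ∫⁻ y in B, imhAcceptE (fun z => (ρ z)⁻¹) x y
        * ENNReal.ofReal (Real.exp (-M) * max (ρ x)⁻¹ (ρ y)⁻¹) ∂q
      = ENNReal.ofReal (Real.exp (-M)) * π B := by
  have hw : Measurable fun z => (ρ z)⁻¹ := hρm.inv
  have hg : Measurable fun y => imhAcceptE (fun z => (ρ z)⁻¹) x y
      * ENNReal.ofReal (Real.exp (-M) * max (ρ x)⁻¹ (ρ y)⁻¹) :=
    ((measurable_imhAcceptE hw).of_uncurry_left).mul (measurable_retroCoin hρm x)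
  rw [hq, setLIntegral_withDensity_eq_setLIntegral_mul _ hρm.ennreal_ofReal hg hB]
  have hpt : ∀ y, ((fun y => ENNReal.ofReal (ρ y)) * fun y => imhAcceptE (fun z => (ρ z)⁻¹) x y
      * ENNReal.ofReal (Real.exp (-M) * max (ρ x)⁻¹ (ρ y)⁻¹)) y = ENNReal.ofReal (Real.exp (-M)) := by
    intro y
    simp only [Pi.mul_apply, imhAcceptE, imhAccept]
    have h1 : 0 ≤ min 1 ((ρ y)⁻¹ / (ρ x)⁻¹) :=
      le_min zero_le_one (div_nonneg (inv_pos.2 (hρ0 y)).le (inv_pos.2 (hρ0 x)).le)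
    rw [← ENNReal.ofReal_mul h1, ← ENNReal.ofReal_mul (hρ0 y).le]
    congr 1
    have hx := hρ0 x
    have hy := hρ0 y
    rw [inv_div_inv]
    rcases le_or_gt (ρ x) (ρ y) with hxy | hxy
    · rw [min_eq_right ((div_le_one hy).2 hxy), max_eq_left ((inv_le_inv₀ hy hx).2 hxy)]
      field_simp
    · rw [min_eq_left ((one_le_div hy).2 hxy.le), max_eq_right ((inv_le_inv₀ hx hy).2 hxy.le)]
      field_simp
  simp_rw [hpt]
  rw [setLIntegral_const]

/-- **Tails part**: `∫⁻_{B} a(x,y)(1 − r(x,y)) q(dy) + (1 − A(x)) 1_B(x) = (1 − e^{−M}) R(x, B)`,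
`R` the residual kernel of `K(x, ·) ≥ e^{−M} π` (`M > 0`). -/
theorem indepMH_retro_tails (hρm : Measurable ρ) (hρ0 : ∀ x, 0 < ρ x)
    (hq : q = π.withDensity fun x => ENNReal.ofReal (ρ x)) (hM0 : 0 < M)
    (hM : ∀ x y, ρ x ≤ Real.exp M * ρ y) (x : Ω) {B : Set Ω} (hB : MeasurableSet B) :
    haveI : Fact (Measurable fun z => (ρ z)⁻¹) := ⟨hρm.inv⟩
    ∫⁻ y in B, imhAcceptE (fun z => (ρ z)⁻¹) x y
        * (1 - ENNReal.ofReal (Real.exp (-M) * max (ρ x)⁻¹ (ρ y)⁻¹)) ∂q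
      + (1 - imhAcceptMass q (fun z => (ρ z)⁻¹) x) * B.indicator 1 x
      = (1 - ENNReal.ofReal (Real.exp (-M))) * Doeblin.residualKernel (indepMH q fun z => (ρ z)⁻¹) π
          (ENNReal.ofReal (Real.exp (-M)))
          (fun x _ hB => (indepMH_exact_doeblin_of_density_ratio hρm hρ0 hq hM).2.2 x hB) x B := by
  haveI : Fact (Measurable fun z => (ρ z)⁻¹) := ⟨hρm.inv⟩
  have hw : Measurable fun z => (ρ z)⁻¹ := hρm.inv
  have hε1 : ENNReal.ofReal (Real.exp (-M)) < 1 := by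
    rw [ENNReal.ofReal_lt_one]
    exact Real.exp_lt_one_iff.2 (by linarith)
  have ham : Measurable fun y => imhAcceptE (fun z => (ρ z)⁻¹) x y :=
    (measurable_imhAcceptE hw).of_uncurry_left
  have hrm := measurable_retroCoin (M := M) hρm x
  have hr1 : ∀ y, ENNReal.ofReal (Real.exp (-M) * max (ρ x)⁻¹ (ρ y)⁻¹) ≤ 1 := fun y => by
    rw [← ENNReal.ofReal_one]
    exact ENNReal.ofReal_le_ofReal (retroCoin_mem hq hM hρ0 x y).2
  -- the heads part is finite and dominated by the accepted part
  have hheads := indepMH_retro_heads (M := M) hρm hρ0 hq x hB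
  have hle : ∀ y, imhAcceptE (fun z => (ρ z)⁻¹) x y
      * ENNReal.ofReal (Real.exp (-M) * max (ρ x)⁻¹ (ρ y)⁻¹) ≤ imhAcceptE (fun z => (ρ z)⁻¹) x y :=
    fun y => by
      calc _ ≤ imhAcceptE (fun z => (ρ z)⁻¹) x y * 1 := mul_le_mul' le_rfl (hr1 y)
        _ = _ := mul_one _
  have hmeas : Measurable fun y => imhAcceptE (fun z => (ρ z)⁻¹) x y
      * ENNReal.ofReal (Real.exp (-M) * max (ρ x)⁻¹ (ρ y)⁻¹) := ham.mul hrm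
  have hfin : ∫⁻ y in B, imhAcceptE (fun z => (ρ z)⁻¹) x y
      * ENNReal.ofReal (Real.exp (-M) * max (ρ x)⁻¹ (ρ y)⁻¹) ∂q ≠ ∞ := by
    rw [hheads]
    exact ENNReal.mul_ne_top ENNReal.ofReal_ne_top (measure_ne_top π B)
  -- `∫ a (1 − r) = ∫ a − ∫ a r`
  have hsub : ∫⁻ y in B, imhAcceptE (fun z => (ρ z)⁻¹) x y
      * (1 - ENNReal.ofReal (Real.exp (-M) * max (ρ x)⁻¹ (ρ y)⁻¹)) ∂q
      = (∫⁻ y in B, imhAcceptE (fun z => (ρ z)⁻¹) x y ∂q) - ENNReal.ofReal (Real.exp (-M)) * π B := by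
    rw [← hheads, ← lintegral_sub hmeas hfin (ae_of_all _ hle)]
    refine lintegral_congr fun y => ?_
    rw [ENNReal.mul_sub (fun _ _ => ne_top_of_le_ne_top ENNReal.one_ne_top
      (imhAcceptE_le_one _ x y)), mul_one]
  have hdom : ENNReal.ofReal (Real.exp (-M)) * π B ≤ ∫⁻ y in B, imhAcceptE (fun z => (ρ z)⁻¹) x y ∂q := by
    rw [← hheads]
    exact lintegral_mono hle
  -- the kernel splits: `K x B = ε π B + (1 − ε) R x B`
  have hK := Doeblin.apply_eq_add_residual (κ := indepMH q fun z => (ρ z)⁻¹) (ν := π)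
    (hmin := fun x _ hB => (indepMH_exact_doeblin_of_density_ratio hρm hρ0 hq hM).2.2 x hB) hε1 x hB
  rw [indepMH_apply hw x hB] at hK
  have hεfin : ENNReal.ofReal (Real.exp (-M)) * π B ≠ ∞ :=
    ENNReal.mul_ne_top ENNReal.ofReal_ne_top (measure_ne_top π B)
  rw [hsub, ENNReal.sub_add_eq_add_sub hdom hεfin]
  refine (ENNReal.eq_sub_of_add_eq hεfin ?_).symm
  rw [hK, add_comm]

/-- **THE COIN-AUGMENTED METROPOLIS STEP IS THE SPLIT KERNEL.**  From `x`: propose `y ∼ q`, accept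
with probability `a(x, y)`; if accepted flip heads with probability `r(x, y) = e^{−M} max(1/ρ x, 1/ρ y)`,
if rejected stay at `x` with tails.  The law of `(new state, coin)` equals
`(e^{−M} π).map (·, heads) + ((1 − e^{−M}) R(x, ·)).map (·, tails)` (`M > 0`). -/
theorem indepMH_retro_eq_split (hρm : Measurable ρ) (hρ0 : ∀ x, 0 < ρ x)
    (hq : q = π.withDensity fun x => ENNReal.ofReal (ρ x)) (hM0 : 0 < M)
    (hM : ∀ x y, ρ x ≤ Real.exp M * ρ y) (x : Ω) :
    haveI : Fact (Measurable fun z => (ρ z)⁻¹) := ⟨hρm.inv⟩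
    (q.withDensity (fun y => imhAcceptE (fun z => (ρ z)⁻¹) x y
        * ENNReal.ofReal (Real.exp (-M) * max (ρ x)⁻¹ (ρ y)⁻¹))).map (fun y : Ω => (y, true))
      + ((q.withDensity (fun y => imhAcceptE (fun z => (ρ z)⁻¹) x y
          * (1 - ENNReal.ofReal (Real.exp (-M) * max (ρ x)⁻¹ (ρ y)⁻¹))))
        + (1 - imhAcceptMass q (fun z => (ρ z)⁻¹) x) • Measure.dirac x).map (fun y : Ω => (y, false))
    = (ENNReal.ofReal (Real.exp (-M)) • π).map (fun y : Ω => (y, true))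
      + ((1 - ENNReal.ofReal (Real.exp (-M))) • Doeblin.residualKernel (indepMH q fun z => (ρ z)⁻¹) π
          (ENNReal.ofReal (Real.exp (-M)))
          (fun x _ hB => (indepMH_exact_doeblin_of_density_ratio hρm hρ0 hq hM).2.2 x hB) x).map
        (fun y : Ω => (y, false)) := by
  haveI : Fact (Measurable fun z => (ρ z)⁻¹) := ⟨hρm.inv⟩
  have H1 : q.withDensity (fun y => imhAcceptE (fun z => (ρ z)⁻¹) x y
      * ENNReal.ofReal (Real.exp (-M) * max (ρ x)⁻¹ (ρ y)⁻¹)) = ENNReal.ofReal (Real.exp (-M)) • π := by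
    ext B hB
    rw [withDensity_apply _ hB, Measure.smul_apply, smul_eq_mul]
    exact indepMH_retro_heads (M := M) hρm hρ0 hq x hB
  have H2 : q.withDensity (fun y => imhAcceptE (fun z => (ρ z)⁻¹) x y
        * (1 - ENNReal.ofReal (Real.exp (-M) * max (ρ x)⁻¹ (ρ y)⁻¹)))
      + (1 - imhAcceptMass q (fun z => (ρ z)⁻¹) x) • Measure.dirac x
      = (1 - ENNReal.ofReal (Real.exp (-M))) • Doeblin.residualKernel (indepMH q fun z => (ρ z)⁻¹) π
          (ENNReal.ofReal (Real.exp (-M)))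
          (fun x _ hB => (indepMH_exact_doeblin_of_density_ratio hρm hρ0 hq hM).2.2 x hB) x := by
    ext B hB
    rw [Measure.add_apply, withDensity_apply _ hB, Measure.smul_apply, smul_eq_mul,
      Measure.dirac_apply' x hB, Measure.smul_apply, smul_eq_mul]
    exact indepMH_retro_tails hρm hρ0 hq hM0 hM x hB
  rw [H1, H2]

/-- **AN IMPLEMENTABLE SPLIT KERNEL EXISTS**: there is a Markov kernel `κ̂` on `Ω × Bool` which, at
every `(x, b)`, IS the coin-augmented Metropolis step from `x` (so it can be simulated knowing `ρ`
up to scale and `M`), and which satisfies the split-kernel equation of `Scoring/SplitChain.lean`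
for `(indepMH q (1/ρ), π, e^{−M})` — so every regenerative certificate applies to it. -/
theorem exists_indepMH_retroKernel (hρm : Measurable ρ) (hρ0 : ∀ x, 0 < ρ x)
    (hq : q = π.withDensity fun x => ENNReal.ofReal (ρ x)) (hM0 : 0 < M)
    (hM : ∀ x y, ρ x ≤ Real.exp M * ρ y) :
    haveI : Fact (Measurable fun z => (ρ z)⁻¹) := ⟨hρm.inv⟩
    ∃ κs : Kernel (Ω × Bool) (Ω × Bool), IsMarkovKernel κs ∧
      (∀ p, κs p = (q.withDensity (fun y => imhAcceptE (fun z => (ρ z)⁻¹) p.1 y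
          * ENNReal.ofReal (Real.exp (-M) * max (ρ p.1)⁻¹ (ρ y)⁻¹))).map (fun y : Ω => (y, true))
        + ((q.withDensity (fun y => imhAcceptE (fun z => (ρ z)⁻¹) p.1 y
            * (1 - ENNReal.ofReal (Real.exp (-M) * max (ρ p.1)⁻¹ (ρ y)⁻¹))))
          + (1 - imhAcceptMass q (fun z => (ρ z)⁻¹) p.1) • Measure.dirac p.1).map
            (fun y : Ω => (y, false))) ∧
      (∀ p, κs p = (ENNReal.ofReal (Real.exp (-M)) • π).map (fun y : Ω => (y, true))
        + ((1 - ENNReal.ofReal (Real.exp (-M))) • Doeblin.residualKernel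
            (indepMH q fun z => (ρ z)⁻¹) π (ENNReal.ofReal (Real.exp (-M)))
            (fun x _ hB => (indepMH_exact_doeblin_of_density_ratio hρm hρ0 hq hM).2.2 x hB) p.1).map
          (fun y : Ω => (y, false))) := by
  haveI : Fact (Measurable fun z => (ρ z)⁻¹) := ⟨hρm.inv⟩
  have hε1 : ENNReal.ofReal (Real.exp (-M)) < 1 := by
    rw [ENNReal.ofReal_lt_one]
    exact Real.exp_lt_one_iff.2 (by linarith)
  obtain ⟨κs, hκsM, hκs⟩ := exists_splitKernel (κ := indepMH q fun z => (ρ z)⁻¹) (ν := π)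
    (hmin := fun x _ hB => (indepMH_exact_doeblin_of_density_ratio hρm hρ0 hq hM).2.2 x hB) hε1
  refine ⟨κs, hκsM, fun p => ?_, hκs⟩
  rw [hκs p, indepMH_retro_eq_split hρm hρ0 hq hM0 hM p.1]

end Retro

end Summit.Ventures.LatticeQCDFlow.Scoring

end
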